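import Summits.CriticalPhenomena.PercolationContinuityZ3.Theorems.Transplant.FKConnectivityAllQTwoSumParts
import Summits.CriticalPhenomena.PercolationContinuityZ3.Theorems.Transplant.FKConnectivityAllQK4
import HarnessLib

/-!
# Connectivity correlation inequalities for `φ_{w,q}`, every `q > 0` — TWO-SUMS, file 4: WAGNER'S TWO-SUM THEOREM (graph case)
# — negative association of `φ_{w,q}`, `0 < q ≤ 1`, is preserved by two-sums and parallel connections

Support file (`--supports stmt-CriticalPhenomena-4575`), FK sub-lane `prim-bschramm-fk-1` (gen 6) of the post-continuity
programme; builds on p205010 (kernel theorem, internal audit signed; external expert review pending).  No definitions, no named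
facts, no sorries; standard axioms.

**`FK.edgeNegCorrSupp_twoSum`** — let `E₁, E₂ ⊆ Sym2 V` be disjoint edge sets living on vertex sets `V₁, V₂` with
`V₁ ∩ V₂ ⊆ {s, t}`, `s ≠ t`, and `0 < q ≤ 1`.  If every weight vector supported in `insert st E₁` gives an edge-negatively
associated random-cluster measure, and likewise for `insert st E₂` (`FK.EdgeNegCorrSupp`, fk-1 g5), then so does every weight vector
supported in `E₁ ∪ E₂`.  Since the pair `st` may itself belong to `E₁ ∪ E₂`, this covers both the TWO-SUM `(E₁ ⊕_{st} E₂)` (glue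
along `st`, delete it) and the PARALLEL CONNECTION (keep it) of Wagner's Theorem 5.8(d) ("the class of Potts–Rayleigh matroids is
closed by taking two-sums"), in its graph case and for the fixed-`q` class `{G : φ_{G,𝐩,q} negatively associated ∀𝐩}`; weights
`0` and `1` (deletion / contraction) are allowed throughout, so minors come for free (`EdgeNegCorrSupp.mono`).
Proof = the two cases of Wagner's proof: pairs in different parts — `negCorr_twoSum_mixed` (the defect factorises as
`(1−q)·Δ₁·Δ₂` with `Δᵢ ≥ 0` the single-edge monotonicity of each part, `spMono_of_edgeNegCorrSupp`); pairs in the same part —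
`negCorr_twoSum_pure` (the other part is an effective edge `st`); plus the bookkeeping of where the real pair `st` lies
(`negCorr_twoSum_sameSide`).  At `q = 1` distinct pairs are independent.
Corollary recorded here: **`FK.edgeNegCorrSupp_twoSum_K4_K4`** — two `K₄`'s sharing an edge (6 vertices, 11 pairs; not
series–parallel, not on `≤ 4` vertices, not apex-grown) carry negatively associated `φ_{w,q}` for all weights and all `0 < q ≤ 1`,
from fk-1 g5's kernel certificate `edgeNegCorr_supp_K4` of Sokal's `K₄` computation; and the hub inequality (ALR (13)) there for
`q ∈ (0,1)`.  The general closure class (single pairs and `K₄`'s under parallel connection ⊇ all 2-trees) is typed in the sibling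
definitions file `…TwoSumClassDefs.lean`.
[cite: Wagner2006, Thm. 5.8(d), §5.3 (pp. 14–15)] [cite: Grimmett2006, §3.9 eq. (3.94) (pp. 63–64)]
[cite: AyyerLinussonRavichandran2025, §7 eq. (13), Conj. 7.1 (p. 22)]
-/

noncomputable section

namespace Summit.CriticalPhenomena.PercolationContinuityZ3.Theorems

namespace FK

open MeasureTheory SimpleGraph Literature.Probability.LatticeModels Literature.Probability.Percolation
open scoped Classical

variable {V : Type*} [Fintype V]

/-! ### Bookkeeping: moving the real pair `st` to the other part -/

section Shift

variable {E₁ E₂ : Set (Sym2 V)} {V₁ V₂ : Set V} {s t : V}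

omit [Fintype V] in
/-- `E₁ ∖ {st}` and `insert st E₂` are disjoint when `E₁, E₂` are. [folklore] -/
theorem disjoint_diff_insert (hd : Disjoint E₁ E₂) (g : Sym2 V) : Disjoint (E₁ \ {g}) (insert g E₂) := by
  rw [Set.disjoint_left]
  rintro e ⟨he₁, heg⟩ (rfl | he₂)
  · exact heg rfl
  · exact Set.disjoint_left.1 hd he₁ he₂

omit [Fintype V] in
/-- The part `insert st E₂` lives on `V₂ ∪ {s, t}`. [folklore] -/
theorem span_insert_pair (h₂ : ∀ e ∈ E₂, ∀ z ∈ e, z ∈ V₂) :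
    ∀ e ∈ insert s(s, t) E₂, ∀ z ∈ e, z ∈ V₂ ∪ {s, t} := by
  rintro e (rfl | he) z hz
  · right
    rcases Sym2.mem_iff.1 hz with rfl | rfl
    · exact Or.inl rfl
    · exact Or.inr rfl
  · exact Or.inl (h₂ e he z hz)

omit [Fintype V] in
/-- The part `E₁ ∖ {st}` still lives on `V₁`. [folklore] -/
theorem span_diff (h₁ : ∀ e ∈ E₁, ∀ z ∈ e, z ∈ V₁) (g : Sym2 V) : ∀ e ∈ E₁ \ {g}, ∀ z ∈ e, z ∈ V₁ :=
  fun e he z hz => h₁ e he.1 z hz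

omit [Fintype V] in
/-- The separator is unchanged: `V₁ ∩ (V₂ ∪ {s,t}) ⊆ {s,t}`. [folklore] -/
theorem inter_union_pair_subset (hS : V₁ ∩ V₂ ⊆ {s, t}) : V₁ ∩ (V₂ ∪ {s, t}) ⊆ ({s, t} : Set V) := by
  rintro z ⟨hz₁, hz₂ | hz₂⟩
  · exact hS ⟨hz₁, hz₂⟩
  · exact hz₂

omit [Fintype V] in
/-- The separator is symmetric. [folklore] -/
theorem inter_subset_symm (hS : V₁ ∩ V₂ ⊆ {s, t}) : V₂ ∩ V₁ ⊆ ({s, t} : Set V) := fun _ hz => hS ⟨hz.2, hz.1⟩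

omit [Fintype V] in
/-- Supports survive the shift: `E₁ ∪ E₂ ⊆ (E₁ ∖ {st}) ∪ insert st E₂`. [folklore] -/
theorem supp_shift {w : Sym2 V → unitInterval} (hw : ∀ g, ((w g : unitInterval) : ℝ) ≠ 0 → g ∈ E₁ ∪ E₂) (a : Sym2 V) :
    ∀ g, ((w g : unitInterval) : ℝ) ≠ 0 → g ∈ (E₁ \ {a}) ∪ insert a E₂ := by
  intro g hg
  by_cases hga : g = a
  · exact Or.inr (hga ▸ Set.mem_insert _ _)
  · rcases hw g hg with h | h
    · exact Or.inl ⟨h, hga⟩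
    · exact Or.inr (Set.mem_insert_of_mem _ h)

omit [Fintype V] in
/-- Supports are symmetric in the parts. [folklore] -/
theorem supp_symm {w : Sym2 V → unitInterval} (hw : ∀ g, ((w g : unitInterval) : ℝ) ≠ 0 → g ∈ E₁ ∪ E₂) :
    ∀ g, ((w g : unitInterval) : ℝ) ≠ 0 → g ∈ E₂ ∪ E₁ := fun g hg => (Set.union_comm E₁ E₂) ▸ hw g hg

end Shift

/-! ### Both pairs in the same part -/

/-- **Two-sum, both pairs in the first part** (`0 < q < 1`): with the two parts negatively associated (virtual edge included),
`w` supported in `E₁ ∪ E₂`, `e, f ∈ E₁`, `e` not a loop, `f ≠ e`: `φ_{w,q}(J_e ∩ J_f) ≤ φ_{w,q}(J_e)φ_{w,q}(J_f)`.  If `st ∉ E₁` this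
is the pure case; if `st ∈ E₁` the real pair `st` is moved to the other part (`E₁ ∖ {st}`, `insert st E₂`), after which it is the
pure case again unless `e` or `f` is `st`, which is a mixed case. [cite: Wagner2006, Thm. 5.8(d), proof (pp. 14–15)]
[cite: Grimmett2006, §3.9 eq. (3.94) (p. 63)] -/
theorem negCorr_twoSum_sameSide {q : ℝ} (hq0 : 0 < q) (hq1 : q < 1) {E₁ E₂ : Set (Sym2 V)} {V₁ V₂ : Set V}
    (hd : Disjoint E₁ E₂) (h₁ : ∀ e ∈ E₁, ∀ z ∈ e, z ∈ V₁) (h₂ : ∀ e ∈ E₂, ∀ z ∈ e, z ∈ V₂) {s t : V}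
    (hS : V₁ ∩ V₂ ⊆ {s, t}) (hst : s ≠ t) (hE₁ : EdgeNegCorrSupp (insert s(s, t) E₁) q)
    (hE₂ : EdgeNegCorrSupp (insert s(s, t) E₂) q) (w : Sym2 V → unitInterval)
    (hw : ∀ g, ((w g : unitInterval) : ℝ) ≠ 0 → g ∈ E₁ ∪ E₂) {e f : Sym2 V} (he : e ∈ E₁) (hf : f ∈ E₁) (hed : ¬ e.IsDiag)
    (hfe : f ≠ e) :
    (rcMeasureW w q ∅).real ({ω | e ∈ ω} ∩ {ω | f ∈ ω}) ≤
      (rcMeasureW w q ∅).real {ω | e ∈ ω} * (rcMeasureW w q ∅).real {ω | f ∈ ω} := by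
  by_cases hst₁ : s(s, t) ∈ E₁
  swap
  · exact negCorr_twoSum_pure w hq0 hd h₁ h₂ hS hst hst₁ hE₁ hw he hf hed hfe
  -- move the real pair `st` to the second part
  have hst₂ : s(s, t) ∉ E₂ := fun h => Set.disjoint_left.1 hd hst₁ h
  have hd' := disjoint_diff_insert hd s(s, t) (E₁ := E₁) (E₂ := E₂)
  have h₁' := span_diff h₁ s(s, t) (E₁ := E₁) (V₁ := V₁)
  have h₂' := span_insert_pair h₂ (E₂ := E₂) (V₂ := V₂) (s := s) (t := t)
  have hS' := inter_union_pair_subset hS (V₁ := V₁) (V₂ := V₂)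
  have hw' := supp_shift hw s(s, t)
  have hK : EdgeNegCorrSupp (insert s(s, t) (E₁ \ {s(s, t)})) q := by rw [Set.insert_sdiff_singleton]; exact hE₁
  have hM : EdgeNegCorrSupp (insert s(s, t) (insert s(s, t) E₂)) q := by
    rw [Set.insert_eq_of_mem (Set.mem_insert _ _)]; exact hE₂
  have hnot : s(s, t) ∉ E₁ \ {s(s, t)} := fun h => h.2 rfl
  by_cases hes : e = s(s, t)
  · -- `e = st` in `insert st E₂`, `f` in `E₁ ∖ {st}`: mixed, parts swapped
    subst hes
    have hfK : f ∈ E₁ \ {s(s, t)} := ⟨hf, hfe⟩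
    have hfM : f ∉ insert s(s, t) E₂ := by
      rintro (h | h)
      · exact hfe h
      · exact Set.disjoint_left.1 hd hf h
    exact negCorr_twoSum_mixed w hq0 hq1.le hd'.symm h₂' h₁' (inter_subset_symm hS') hst (supp_symm hw') hnot hfM
      (spMono_of_edgeNegCorrSupp hq0 hq1 hst hM w _) (spMono_of_edgeNegCorrSupp hq0 hq1 hst hK w _)
  by_cases hfs : f = s(s, t)
  · -- `e` in `E₁ ∖ {st}`, `f = st` in `insert st E₂`: mixed
    subst hfs
    have heK : e ∈ E₁ \ {s(s, t)} := ⟨he, hes⟩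
    have heM : e ∉ insert s(s, t) E₂ := by
      rintro (h | h)
      · exact hes h
      · exact Set.disjoint_left.1 hd he h
    exact negCorr_twoSum_mixed w hq0 hq1.le hd' h₁' h₂' hS' hst hw' heM hnot
      (spMono_of_edgeNegCorrSupp hq0 hq1 hst hK w _) (spMono_of_edgeNegCorrSupp hq0 hq1 hst hM w _)
  · -- both in `E₁ ∖ {st}`: pure
    exact negCorr_twoSum_pure w hq0 hd' h₁' h₂' hS' hst hnot hK hw' ⟨he, hes⟩ ⟨hf, hfs⟩ hed hfe

/-! ### The theorem -/

/-- **Wagner's two-sum theorem, graph case (Ann. Comb. 12 (2008), Thm. 5.8(d)) — kernel version for `φ_{w,q}`, `0 < q ≤ 1`.**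
Let `E₁, E₂` be disjoint edge sets on vertex sets `V₁, V₂` with `V₁ ∩ V₂ ⊆ {s, t}`, `s ≠ t`.  If the random-cluster measure is
edge-negatively associated for every weight vector supported in `insert st E₁`, and for every weight vector supported in
`insert st E₂`, then it is edge-negatively associated for every weight vector supported in `E₁ ∪ E₂`:
`φ_{w,q}(J_e ∩ J_f) ≤ φ_{w,q}(J_e)·φ_{w,q}(J_f)` for all non-loop `e` and all `f ≠ e`.  Covers the two-sum (`st` deleted) and the
parallel connection (`st ∈ E₁ ∪ E₂` kept); parameters `0`/`1` = deletion/contraction are allowed.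
[cite: Wagner2006, Thm. 5.8(d), §5.3 (pp. 14–15)] [cite: Grimmett2006, §3.9 eq. (3.94) (pp. 63–64)] -/
theorem edgeNegCorrSupp_twoSum {q : ℝ} (hq0 : 0 < q) (hq1 : q ≤ 1) {E₁ E₂ : Set (Sym2 V)} {V₁ V₂ : Set V}
    (hd : Disjoint E₁ E₂) (h₁ : ∀ e ∈ E₁, ∀ z ∈ e, z ∈ V₁) (h₂ : ∀ e ∈ E₂, ∀ z ∈ e, z ∈ V₂) {s t : V}
    (hS : V₁ ∩ V₂ ⊆ {s, t}) (hst : s ≠ t) (hE₁ : EdgeNegCorrSupp (insert s(s, t) E₁) q)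
    (hE₂ : EdgeNegCorrSupp (insert s(s, t) E₂) q) : EdgeNegCorrSupp (E₁ ∪ E₂) q := by
  rcases hq1.lt_or_eq with hlt | heq
  swap
  · subst heq
    intro w _ e f _ hfe
    exact negCorr_of_q_one w e f hfe
  intro w hw e f hed hfe
  by_cases hwe : ((w e : unitInterval) : ℝ) = 0
  · exact negCorr_of_weight_zero_left hq0 w f hwe
  by_cases hwf : ((w f : unitInterval) : ℝ) = 0
  · exact negCorr_of_weight_zero_right hq0 w e hwf
  rcases hw e hwe with he | he <;> rcases hw f hwf with hf | hf
  · exact negCorr_twoSum_sameSide hq0 hlt hd h₁ h₂ hS hst hE₁ hE₂ w hw he hf hed hfe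
  · exact negCorr_twoSum_mixed w hq0 hq1 hd h₁ h₂ hS hst hw (fun h => Set.disjoint_left.1 hd he h)
      (fun h => Set.disjoint_left.1 hd h hf) (spMono_of_edgeNegCorrSupp hq0 hlt hst hE₁ w e)
      (spMono_of_edgeNegCorrSupp hq0 hlt hst hE₂ w f)
  · exact negCorr_twoSum_mixed w hq0 hq1 hd.symm h₂ h₁ (inter_subset_symm hS) hst (supp_symm hw)
      (fun h => Set.disjoint_left.1 hd h he) (fun h => Set.disjoint_left.1 hd hf h)
      (spMono_of_edgeNegCorrSupp hq0 hlt hst hE₂ w e) (spMono_of_edgeNegCorrSupp hq0 hlt hst hE₁ w f)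
  · exact negCorr_twoSum_sameSide hq0 hlt hd.symm h₂ h₁ (inter_subset_symm hS) hst hE₂ hE₁ w (supp_symm hw) he hf hed hfe

/-- **Parallel connection along a common pair**: if `E₁ ∩ E₂ = {st}`-wise the two edge sets share exactly the pair `st`
(`E₁ ∖ {st}` disjoint from `E₂`), live on `V₁, V₂` with `V₁ ∩ V₂ ⊆ {s,t}`, and each carries negatively associated `φ_{w,q}` for all
weights, then so does `E₁ ∪ E₂` (`0 < q ≤ 1`).  The form used to grow classes of supports. [cite: Wagner2006, Thm. 5.8(d), §5.3 (pp. 14–15)] -/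
theorem edgeNegCorrSupp_parallelConnection {q : ℝ} (hq0 : 0 < q) (hq1 : q ≤ 1) {E₁ E₂ : Set (Sym2 V)} {V₁ V₂ : Set V}
    {s t : V} (hst : s ≠ t) (hst₁ : s(s, t) ∈ E₁) (hst₂ : s(s, t) ∈ E₂) (hd : Disjoint (E₁ \ {s(s, t)}) E₂)
    (h₁ : ∀ e ∈ E₁, ∀ z ∈ e, z ∈ V₁) (h₂ : ∀ e ∈ E₂, ∀ z ∈ e, z ∈ V₂) (hS : V₁ ∩ V₂ ⊆ {s, t})
    (hE₁ : EdgeNegCorrSupp E₁ q) (hE₂ : EdgeNegCorrSupp E₂ q) : EdgeNegCorrSupp (E₁ ∪ E₂) q := by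
  have hunion : (E₁ \ {s(s, t)}) ∪ E₂ = E₁ ∪ E₂ := by
    ext g
    simp only [Set.mem_union, Set.mem_sdiff, Set.mem_singleton_iff]
    constructor
    · rintro (⟨h, -⟩ | h)
      · exact Or.inl h
      · exact Or.inr h
    · rintro (h | h)
      · by_cases hg : g = s(s, t)
        · exact Or.inr (hg ▸ hst₂)
        · exact Or.inl ⟨h, hg⟩
      · exact Or.inr h
  rw [← hunion]
  refine edgeNegCorrSupp_twoSum hq0 hq1 hd (span_diff h₁ _) h₂ hS hst ?_ ?_
  · rw [Set.insert_sdiff_singleton, Set.insert_eq_of_mem hst₁]; exact hE₁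
  · rw [Set.insert_eq_of_mem hst₂]; exact hE₂

/-! ### First new support class: two `K₄`'s sharing an edge -/

omit [Fintype V] in
/-- The six pairs of a `K₄` on `x, y, z, t` live on `{x, y, z, t}`. [folklore] -/
theorem span_K4 (x y z t : V) :
    ∀ e ∈ ({s(x, y), s(x, z), s(x, t), s(y, z), s(y, t), s(z, t)} : Set (Sym2 V)), ∀ a ∈ e,
      a ∈ ({x, y, z, t} : Set V) := by
  intro e he a ha
  simp only [Set.mem_insert_iff, Set.mem_singleton_iff] at he ⊢
  rcases he with rfl | rfl | rfl | rfl | rfl | rfl <;> (rw [Sym2.mem_iff] at ha; rcases ha with rfl | rfl <;> simp)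

/-- **Two `K₄`'s glued along an edge are negatively associated for all weights and all `0 < q ≤ 1`**: for six distinct vertices
`x, y, s, t, u, v`, every `φ_{w,q}` with `w` supported in the 11 pairs of `K₄(x,y,s,t) ∪ K₄(u,v,s,t)` satisfies
`φ(J_e ∩ J_f) ≤ φ(J_e)φ(J_f)` (`e` not a loop, `f ≠ e`).  The parallel connection of two `K₄`'s: neither series–parallel nor on `≤ 4`
vertices nor apex-grown — the first support beyond the classes certified so far (fk-1 g5 / fk-3 g6 / fk-2 g7), from Sokal's `K₄`
computation (kernel: `edgeNegCorr_supp_K4`) and the two-sum theorem. [cite: Wagner2006, Ex. 5.1, Thm. 5.8(d), §5.3 (pp. 13–15)]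
[cite: Grimmett2006, §3.9 eq. (3.94) (p. 63)] -/
theorem edgeNegCorrSupp_twoSum_K4_K4 {q : ℝ} (hq0 : 0 < q) (hq1 : q ≤ 1) {x y s t u v : V} (hxy : x ≠ y) (hxs : x ≠ s)
    (hxt : x ≠ t) (hys : y ≠ s) (hyt : y ≠ t) (hst : s ≠ t) (huv : u ≠ v) (hus : u ≠ s) (hut : u ≠ t) (hvs : v ≠ s)
    (hvt : v ≠ t) (hxu : x ≠ u) (hxv : x ≠ v) (hyu : y ≠ u) (hyv : y ≠ v) :
    EdgeNegCorrSupp (({s(x, y), s(x, s), s(x, t), s(y, s), s(y, t), s(s, t)} : Set (Sym2 V)) ∪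
      {s(u, v), s(u, s), s(u, t), s(v, s), s(v, t), s(s, t)}) q := by
  refine edgeNegCorrSupp_parallelConnection hq0 hq1 hst (by simp) (by simp) ?_ (span_K4 x y s t) (span_K4 u v s t) ?_
    (edgeNegCorr_supp_K4 hq0 hq1 hxy hxs hxt hys hyt hst) (edgeNegCorr_supp_K4 hq0 hq1 huv hus hut hvs hvt hst)
  · rw [Set.disjoint_left]
    rintro g ⟨hg₁, hg⟩ hg₂
    simp only [Set.mem_insert_iff, Set.mem_singleton_iff] at hg₁ hg₂ hg
    rcases hg₁ with rfl | rfl | rfl | rfl | rfl | rfl <;>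
      rcases hg₂ with h | h | h | h | h | h <;>
      simp_all
  · rintro z ⟨hz₁, hz₂⟩
    simp only [Set.mem_insert_iff, Set.mem_singleton_iff] at hz₁ hz₂ ⊢
    rcases hz₁ with rfl | rfl | rfl | rfl <;> rcases hz₂ with h | h | h | h <;> simp_all

/-- **The hub inequality (ALR (13)) on two `K₄`'s sharing an edge, every `q ∈ (0,1)`**: for `w` supported there and the path
`o – a – b` inside the support, `φ_{w,q}(o ↔ a)·φ_{w,q}(b ↔ a) ≤ φ_{w,q}(o ↔ a ↔ b)`; e.g. across the two blocks, `o = x`, `a = s`,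
`b = u`. [cite: AyyerLinussonRavichandran2025, §7 eq. (13), Conj. 7.1 (p. 22)] [cite: Wagner2006, Thm. 5.8(d), §5.3] -/
theorem hubUnder_twoSum_K4_K4 {q : ℝ} (hq0 : 0 < q) (hq1 : q < 1) {x y s t u v : V} (hxy : x ≠ y) (hxs : x ≠ s)
    (hxt : x ≠ t) (hys : y ≠ s) (hyt : y ≠ t) (hst : s ≠ t) (huv : u ≠ v) (hus : u ≠ s) (hut : u ≠ t) (hvs : v ≠ s)
    (hvt : v ≠ t) (hxu : x ≠ u) (hxv : x ≠ v) (hyu : y ≠ u) (hyv : y ≠ v) (w : Sym2 V → unitInterval)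
    (hw : ∀ e, ((w e : unitInterval) : ℝ) ≠ 0 → e ∈ (({s(x, y), s(x, s), s(x, t), s(y, s), s(y, t), s(s, t)} : Set (Sym2 V)) ∪
      {s(u, v), s(u, s), s(u, t), s(v, s), s(v, t), s(s, t)})) :
    HubUnder (rcMeasureW w q ∅) x s u :=
  hubUnder_of_edgeNegCorr_on hq0 hq1 _
    (edgeNegCorrSupp_twoSum_K4_K4 hq0 hq1.le hxy hxs hxt hys hyt hst huv hus hut hvs hvt hxu hxv hyu hyv) x s u
    (by simp) (by simp [Sym2.eq_swap]) w hw

end FK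

end Summit.CriticalPhenomena.PercolationContinuityZ3.Theorems

end
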